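import Literature.MathematicalPhysics.QuantumFieldTheory.Balaban1983to89.B9Eq315PeriodicReadingZdPer
import Literature.MathematicalPhysics.QuantumFieldTheory.Balaban1983to89.B11Eq103H1Complex

/-!
# `Balaban1983to89.B9Eq321ProjectionTransportZdPer` — [Balaban1985BackgroundPropagators] (3.21)–(3.23) p. 394 AT THE FLAT BACKGROUND ON THE TORUS `T_η` READ ON
# `ℤᵈ`: TRANSPORT OF THE ORTHOGONAL PROJECTION `R(U₀)` ALONG A PAIRING-ISOMETRY, AND THE NE9 CHAIN'S `L²` SITE SPACE READ IN THE N06 JUNCTION'S TRACE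
# CURRENCY — bridge storey S2a: (i) an orthogonal projection (`Submodule.starProjection` in a Hilbert space, the NE9 chain's `B11Eq103H1Complex.projR ∕
# RLatticeK`) is carried by any linear map `Ψ` that is an isometry «inner product ↦ c·(bilinear form)» onto the form-projection (`Submodule.projection` along
# the form-orthogonal complement, dag-n06-w4's `projEPer`); (ii) with the τ-isometric fibre coordinates `φ` of `B9HilbertSchmidtFibreCoordinates` the NE9
# `SiteL2K` inner product of two `W`-valued torus site functions IS `c₀·Σ_{x∈[0,P)ᵈ} Re τ((φ f(x̄))* (φ g(x̄)))` (dag-n06-w4's `trForm τ (box P)`); (iii) the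
# flat covariant Laplacian `covLaplaceSiteK` ((3.23)) read on `ℤᵈ` through `φ` is the N06 stencil `covLap η 1`

statement-level skeleton of published theorems with citation tags; proofs where landed; nothing here is a claim about the
Yang–Mills mass gap

`[Balaban1985BackgroundPropagators]` ("B9", CMP **99** (1985) 389–434) (3.21) p. 394 *«R(U₀) is the orthogonal projection onto Δ^η_{U₀}N(Q′)»* (typed in the
tree as `B11Eq103H1Complex.projR` — «Mathlib's `Submodule.starProjection` of `(ker Q′).map Δs`» — and as `B9Eq321LandauProjectionZdPer.projEPer` — «the
projection onto `rangeSubPer` along its `formPer`-orthogonal complement»), (3.22) p. 394 *«Rf = Δ^η_Uλ₀»*, (3.23) p. 394 *«Δ^η_U = D^{η*}_U D^η_U»*, (3.11) p. 392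
(the `L²` pairings), p. 391 *«X·Y = tr XY»*.  PDF held: `paper:balaban1985-cmp99-background-propagators` pp. 391–394 (via the tree's `B11Eq103H1Complex` ∕
`B9Eq321LandauProjectionZdPer` docstrings, re-read 2026-08-28).

CITATION HEADER (lean-in-tree rule).  Cell `pub-ymgap` (YM Track A, HUMAN RULINGS D-0062 ∕ D-0149), node N06 = [B9], width seat `pub-ymgap-dag-n06-w3` (g6),
CLAIM-5 (bus 2026-08-28; bridge storey S2a of LOCATED-BRIDGE 14:27Z).  WHY.  The NE9 chain's `R` letter is a Hilbert-space orthogonal projection on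
`SiteL2K ℂ d Pd c₀ W` (`RLatticeK c R S Q′ = projR (covLaplaceSiteK c R S) Q′`); the N06 periodic road's is dag-n06-w4's `projEPer ∕ projRPer` on the real
space `perSub P` with the trace form `formPer`.  Storey S2 of the bridge identifies them at the flat background; THIS FILE (S2a) supplies the three
letter-independent ingredients: the ABSTRACT transport of projections along a pairing-isometry (§1), the READING of the NE9 `L²` pairing in trace currency
through the fibre coordinates `φ` of `B9HilbertSchmidtFibreCoordinates` and the cell sums of `B9Eq315PeriodicReadingZdPer` (§2), and the flat Laplacian
reading (§3).  The `N(Q′)`-match and the Hermitian symmetrisation (S2b) then give `projRPer … 1 ∘ (read) = (read) ∘ RLatticeK … (1)` on Hermitian data.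
Inputs BY NAME: Mathlib `Submodule.starProjection ∕ sub_starProjection_mem_orthogonal ∕ projection_apply_of_mem_left ∕ _right`, `B9Eq311L2Pairing.WL2.inner_def`,
`B11Eq103H1Complex.covLaplaceSiteK ∕ equiv_covDerivL2K ∕ equiv_covDivL2K`, S1's `sum_box_eq_sum_univ_liftSite ∕ covDiv_flat_perSite ∕ perCfg_covDeriv_flat`.

WHAT IS PROVED (kernel, 0 sorry, 0 def; [folklore] linear algebra + bookkeeping — the cited sentences are print's definitions).
* §1 ★★ `map_starProjection_eq_projection_span` (TRANSPORT OF ORTHOGONAL PROJECTIONS: `Ψ : E →ₗ[ℝ] F` with `B(Ψu, Ψv) = c·Re⟪u, v⟫`, `V ≤ E`, `G ⊆ F` a set of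
  `Ψ`-images of `V`, `span G ⊕ (span G)^{⊥_B} = F`, and `Ψ(P_V u) ∈ span G` ⟹ `Ψ(P_V u) = proj_{span G}(Ψu)`), ★ `map_starProjection_eq_projection_map` (the case
  `G = Ψ(V)`).
* §2 ★★ `re_inner_siteL2K_eq_mul_sum_box` (THE NE9 SITE PAIRING IN TRACE CURRENCY: for `f g : SiteL2K ℂ d (P,…,P) c₀ (EuclideanSpace ℂ (Fin n))` and a τ-isometric
  `φ`, `Re⟪f, g⟫ = c₀ · Σ_{x∈[0,P)ᵈ} Re τ((φ f x̄)* (φ g x̄))`), `re_inner_siteL2K_eq_mul_trForm` (= `c₀ · trForm τ (box P) (read f) (read g)`).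
* §3 ★ `read_covLaplaceSiteK_flat` ((3.23) at `U₀ = 1` read on `ℤᵈ` through `φ`: `φ((Δ¹ l)(x̄)) = (covLap η 1 (φ ∘ l ∘ perSite))(x)`), `read_covDerivL2K_flat`.

HONEST SCOPE.  Count-neutral helper (`--supports` the K1 item of record); NO estimate; the `N(Q′)` match and the final `R`-letter identity are storey S2b (not
here); nothing of the NE9 chain's theorems transported yet; Thm 3.11 ∕ 3.3 NOT proved; N05 ∕ N06 NOT discharged; K1 NOT closed; one finite `𝕋⁴` programme at
fixed `ε`, Bałaban as printed; R4 closes only the conditional finite-`𝕋⁴` rung `BalabanLadder.UV` — nothing continuum ∕ ℝ⁴ ∕ OS ∕ mass gap ∕ Clay.  Unit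
`pub-ymgap-dag-n06-w3` (g6), 2026-08-28; NEW file importing `B9Eq315PeriodicReadingZdPer` and `B11Eq103H1Complex` (the fibre `φ` enters as a HYPOTHESIS
`hφ`, supplied by `B9HilbertSchmidtFibreCoordinates.exists_euclidean_coordinates_of_faithful_trace`); modifies
nothing.  Net new unproved facts: 0.
-/

noncomputable section

open scoped BigOperators InnerProductSpace ComplexConjugate

namespace Literature.MathematicalPhysics.QuantumFieldTheory.Balaban1983to89.B9Eq321ProjectionTransportZdPer

open B4Sect5Torus (TSite)
open B9SectCLatticeCarrier (Bond)
open B9Eq311L2Pairing (WL2)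
open B11Eq103H1Complex (SiteL2K BondL2K covDerivL2K covDivL2K covLaplaceSiteK equiv_covDerivL2K equiv_covDivL2K)
open B9Eq33CovDerivVector (covDeriv covDiv)
open B9Eq315QTorus (perSite perCfg perCfg_apply)
open B9Eq315QTorusOnto (liftSite perSite_liftSite)
open B8Ineq132 (covDerivFwd)
open B8Eq138LandauZd (covDivB covLap)
open T4TermwiseTorus (box)
open B9Eq321LandauProjectionZd (trForm trForm_apply)
open B9Eq315PeriodicReadingZdPer (sum_box_eq_sum_univ_liftSite covDiv_flat_perSite perCfg_covDeriv_flat)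

/-! ## §1  Transport of an orthogonal projection along a pairing-isometry -/

section Transport

variable {E : Type*} [NormedAddCommGroup E] [InnerProductSpace ℂ E] [FiniteDimensional ℂ E]
variable {F : Type*} [AddCommGroup F] [Module ℝ F]

/-- ★★ **TRANSPORT OF AN ORTHOGONAL PROJECTION ALONG A PAIRING-ISOMETRY** ((3.21) «R(U₀) is the orthogonal projection onto Δ^η_{U₀}N(Q′)» typed twice in the
tree — as a Hilbert-space `starProjection` and as a `Submodule.projection` along a form-orthogonal complement): let `Ψ : E →ₗ[ℝ] F` carry the real part of the
inner product to a multiple of a bilinear form, `B(Ψu, Ψv) = c·Re⟪u, v⟫`; let `V ≤ E` and `G ⊆ F` a set of `Ψ`-IMAGES OF ELEMENTS OF `V` whose span is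
`B`-complemented; then for every `u` whose projection `P_V u` is read INSIDE `span G`, `Ψ(P_V u)` is the projection of `Ψu` onto `span G` along
`(span G)^{⊥_B}` — because `Ψu − Ψ(P_V u) = Ψ(u − P_V u)` is `B`-orthogonal to every generator. [cite: Balaban1985BackgroundPropagators, (3.21)–(3.22) p.394] -/
theorem map_starProjection_eq_projection_span (B : LinearMap.BilinForm ℝ F) (Ψ : E →ₗ[ℝ] F) (c : ℝ)
    (hΨ : ∀ u v : E, B (Ψ u) (Ψ v) = c * RCLike.re ⟪u, v⟫_ℂ)
    (V : Submodule ℂ E) (G : Set F) (hG : ∀ g ∈ G, ∃ v ∈ V, Ψ v = g)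
    (h : IsCompl (Submodule.span ℝ G) (B.orthogonal (Submodule.span ℝ G))) (u : E)
    (hu : Ψ (V.starProjection u) ∈ Submodule.span ℝ G) :
    Ψ (V.starProjection u) = (Submodule.span ℝ G).projection (B.orthogonal (Submodule.span ℝ G)) h (Ψ u) := by
  have hz : Ψ u - Ψ (V.starProjection u) ∈ B.orthogonal (Submodule.span ℝ G) := by
    rw [LinearMap.BilinForm.mem_orthogonal_iff]
    intro n hn
    show B n (Ψ u - Ψ (V.starProjection u)) = 0
    induction hn using Submodule.span_induction with
    | mem g hg =>
      obtain ⟨v, hv, rfl⟩ := hG g hg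
      rw [← map_sub, hΨ, Submodule.inner_right_of_mem_orthogonal hv (V.sub_starProjection_mem_orthogonal u), map_zero, mul_zero]
    | zero => rw [map_zero, LinearMap.zero_apply]
    | add a b _ _ ha hb => rw [map_add, LinearMap.add_apply, ha, hb, add_zero]
    | smul r a _ ha => rw [map_smul, LinearMap.smul_apply, ha, smul_zero]
  have hsplit : Ψ u = Ψ (V.starProjection u) + (Ψ u - Ψ (V.starProjection u)) := by abel
  rw [hsplit, map_add, Submodule.projection_apply_of_mem_left h hu, Submodule.projection_apply_of_mem_right h hz, add_zero]

/-- ★ **THE CASE `G = Ψ(V)`**: if the target subspace IS the image of `V`, no membership hypothesis is needed — `Ψ ∘ P_V = proj_{Ψ(V)} ∘ Ψ`.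
[cite: Balaban1985BackgroundPropagators, (3.21)–(3.22) p.394] -/
theorem map_starProjection_eq_projection_map (B : LinearMap.BilinForm ℝ F) (Ψ : E →ₗ[ℝ] F) (c : ℝ)
    (hΨ : ∀ u v : E, B (Ψ u) (Ψ v) = c * RCLike.re ⟪u, v⟫_ℂ) (V : Submodule ℂ E)
    (h : IsCompl (Submodule.span ℝ (Ψ '' (V : Set E))) (B.orthogonal (Submodule.span ℝ (Ψ '' (V : Set E))))) (u : E) :
    Ψ (V.starProjection u) =
      (Submodule.span ℝ (Ψ '' (V : Set E))).projection (B.orthogonal (Submodule.span ℝ (Ψ '' (V : Set E)))) h (Ψ u) :=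
  map_starProjection_eq_projection_span B Ψ c hΨ V _ (fun g hg => by
      obtain ⟨v, hv, hgv⟩ := hg
      exact ⟨v, hv, hgv⟩) h u
    (Submodule.subset_span ⟨V.starProjection u, V.starProjection_apply_mem u, rfl⟩)

end Transport

/-! ## §2  The NE9 `L²` site pairing in trace currency -/

section Currency

variable {d : ℕ} (P : ℕ) [NeZero P] {𝔸 : Type*} [CStarAlgebra 𝔸] (τ : 𝔸 →ₗ[ℂ] ℂ) {n : ℕ} {c₀ : ℝ} [Fact (0 < c₀)]
  (φ : EuclideanSpace ℂ (Fin n) ≃ₗ[ℂ] 𝔸) (hφ : ∀ x y : EuclideanSpace ℂ (Fin n), τ (star (φ x) * φ y) = ⟪x, y⟫_ℂ)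

include hφ in
/-- ★★ **THE NE9 SITE PAIRING IN TRACE CURRENCY**: for `W := EuclideanSpace ℂ (Fin n)` read in the algebra by a τ-isometric `φ` (`B9HilbertSchmidtFibreCoordinates`),
the real part of the `SiteL2K ℂ d (P,…,P) c₀ W` inner product of `f, g` is `c₀ · Σ_{x∈[0,P)ᵈ} Re τ((φ f(x̄))* (φ g(x̄)))`, `x̄ = perSite x` — the summands of
dag-n06-w4's `trForm ∕ formPer` and dag-n06-b's `bondPairPer`. [cite: Balaban1985BackgroundPropagators, (3.11) p.392, p.391 («X·Y = tr XY»)] -/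
theorem re_inner_siteL2K_eq_mul_sum_box (f g : SiteL2K ℂ d (fun _ : Fin d => P) c₀ (EuclideanSpace ℂ (Fin n))) :
    RCLike.re ⟪f, g⟫_ℂ = c₀ * ∑ x ∈ box (d := d) P,
      (τ (star (φ (WL2.equiv ℂ _ _ f (perSite (fun _ : Fin d => P) x))) * φ (WL2.equiv ℂ _ _ g (perSite (fun _ : Fin d => P) x)))).re := by
  rw [WL2.inner_def, map_sum, sum_box_eq_sum_univ_liftSite P, Finset.mul_sum]
  refine Finset.sum_congr rfl fun y _ => ?_
  rw [perSite_liftSite, hφ]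
  show (((c₀ : ℝ) : ℂ) * _).re = _
  rw [Complex.re_ofReal_mul]

include hφ in
/-- **… = `c₀ · trForm τ (box P)` of the readings** (dag-n06-w4's cell trace form). [cite: Balaban1985BackgroundPropagators, (3.11) p.392, p.391] -/
theorem re_inner_siteL2K_eq_mul_trForm (f g : SiteL2K ℂ d (fun _ : Fin d => P) c₀ (EuclideanSpace ℂ (Fin n))) :
    RCLike.re ⟪f, g⟫_ℂ = c₀ * trForm τ (box (d := d) P)
      (fun x => φ (WL2.equiv ℂ _ _ f (perSite (fun _ : Fin d => P) x))) (fun x => φ (WL2.equiv ℂ _ _ g (perSite (fun _ : Fin d => P) x))) := by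
  rw [re_inner_siteL2K_eq_mul_sum_box P τ φ hφ, trForm_apply]

end Currency

/-! ## §3  The flat letters of `B11Eq103H1Complex` read on `ℤᵈ` through the fibre coordinates -/

section FlatLetters

variable {d : ℕ} (P : ℕ) [NeZero P] {𝔸 : Type*} [CStarAlgebra 𝔸] {n : ℕ} {c₀ : ℝ} [Fact (0 < c₀)] (η : ℝ)
  (φ : EuclideanSpace ℂ (Fin n) ≃ₗ[ℂ] 𝔸)

omit [NeZero P] in
/-- the fibre coordinates commute with the flat derivative (3.3) of `B9Eq33CovDerivVector` (a `ℂ`-linear stencil). [cite: Balaban1985BackgroundPropagators, (3.3) p.391] -/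
theorem map_covDeriv_flat_torus (c : ℂ) (g : TSite d (fun _ : Fin d => P) → EuclideanSpace ℂ (Fin n)) (b : Bond d (fun _ : Fin d => P)) :
    φ (covDeriv c (fun _ => LinearMap.id) g b) = covDeriv c (fun _ => LinearMap.id) (fun y => φ (g y)) b := by
  rw [B9Eq33CovDerivVector.covDeriv_apply_flat, B9Eq33CovDerivVector.covDeriv_apply_flat, map_smul, map_sub]

omit [NeZero P] in
/-- the fibre coordinates commute with the flat divergence (3.8) of `B9Eq33CovDerivVector`. [cite: Balaban1985BackgroundPropagators, (3.8) p.392] -/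
theorem map_covDiv_flat_torus (c : ℂ) (B : Bond d (fun _ : Fin d => P) → EuclideanSpace ℂ (Fin n)) (y : TSite d (fun _ : Fin d => P)) :
    φ (covDiv c (fun _ => LinearMap.id) B y) = covDiv c (fun _ => LinearMap.id) (fun b => φ (B b)) y := by
  rw [B9Eq33CovDerivVector.covDiv_apply, B9Eq33CovDerivVector.covDiv_apply, map_smul, map_sum]
  simp only [LinearMap.id_apply, map_sub]

/-- ★ **(3.3) AT `U₀ = 1` ON THE `L²` SITE SPACE, READ ON `ℤᵈ` THROUGH `φ`**: `φ((D¹ l)(b̄)) ` read at the `ℤᵈ`-bond `(x, μ)` is `(covDerivFwd η 1 μ (φ ∘ l ∘ perSite))(x)`.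
[cite: Balaban1985BackgroundPropagators, (3.3) p.391] -/
theorem read_covDerivL2K_flat (l : SiteL2K ℂ d (fun _ : Fin d => P) c₀ (EuclideanSpace ℂ (Fin n))) (x : B7Prop1Explicit.Site d) (μ : Fin d) :
    φ (WL2.equiv ℂ _ _ (covDerivL2K ℂ c₀ (((η⁻¹ : ℝ) : ℂ)) (fun _ => LinearMap.id) l) (perSite (fun _ : Fin d => P) x, μ)) =
      covDerivFwd η (1 : B7Prop1Explicit.Site d → Fin d → 𝔸ˣ) μ (fun z => φ (WL2.equiv ℂ _ _ l (perSite (fun _ : Fin d => P) z))) x := by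
  rw [equiv_covDerivL2K, map_covDeriv_flat_torus]
  have h := congr_fun (congr_fun (perCfg_covDeriv_flat P η (fun y => φ (WL2.equiv ℂ _ _ l y))) x) μ
  rw [perCfg_apply] at h
  exact h

/-- ★ **(3.23) AT `U₀ = 1` ON THE `L²` SITE SPACE, READ ON `ℤᵈ` THROUGH `φ`**: `φ((Δ¹ l)(x̄)) = (covLap η 1 (φ ∘ l ∘ perSite))(x)` — the NE9 chain's flat
`covLaplaceSiteK` is the N06 stencil `covLap η 1` on the readings. [cite: Balaban1985BackgroundPropagators, (3.23) p.394] -/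
theorem read_covLaplaceSiteK_flat (l : SiteL2K ℂ d (fun _ : Fin d => P) c₀ (EuclideanSpace ℂ (Fin n))) (x : B7Prop1Explicit.Site d) :
    φ (WL2.equiv ℂ _ _ (covLaplaceSiteK (((η⁻¹ : ℝ) : ℂ)) (fun _ => LinearMap.id) (fun _ => LinearMap.id) l) (perSite (fun _ : Fin d => P) x)) =
      covLap η (1 : B7Prop1Explicit.Site d → Fin d → 𝔸ˣ) (fun z => φ (WL2.equiv ℂ _ _ l (perSite (fun _ : Fin d => P) z))) x := by
  rw [covLaplaceSiteK, LinearMap.comp_apply, equiv_covDivL2K, map_covDiv_flat_torus, covDiv_flat_perSite, covLap]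
  congr 1
  funext z μ
  rw [perCfg_apply, ← read_covDerivL2K_flat P η φ l z μ]

end FlatLetters

end Literature.MathematicalPhysics.QuantumFieldTheory.Balaban1983to89.B9Eq321ProjectionTransportZdPer

end
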